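import Literature.RepresentationTheory.FiniteGroups.PSL27DegreeThreeModSeven
import Literature.RepresentationTheory.FiniteGroups.PSL27ToGL32
import Literature.RepresentationTheory.FiniteGroups.SL27TraceFacts
import Literature.RepresentationTheory.FiniteGroups.FiniteOrderCharpolyGL3
import Mathlib.Tactic.LinearCombination
import HarnessLib

/-!
# Proof of `psl27_degreeThree_charpoly_mod_seven`

RepresentationTheory/FiniteGroups file: the DISCHARGE
`psl27_degreeThree_charpoly_mod_seven_holds` of the named fact of
`PSL27DegreeThreeModSeven.lean` (Bonnafé, *Representations of `SL₂(𝔽_q)`*, Table 11.4,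
Prop 10.2.9 (f), Prop 11.4.4: the degree-`3` characters of `PSL₂(𝔽₇) ≅ GL₃(𝔽₂)` reduce modulo
`7` to `L(2) = Sym² = Ad⁰`, in characteristic-polynomial form), fully proved; no definitions, no
named facts.

## The proof

Bonnafé's own route (Deligne–Lusztig characters `R'_±(θ₀)`, the decomposition matrix of
`SL₂(𝔽_q)` in natural characteristic, Thm 10.1.8 / Prop 10.2.9) is far beyond Mathlib; the
statement, however, is a finite fact about one group of order `336`, and we prove it by the
elementary eigenvalue bookkeeping that the character table 11.4 encodes:

1. (`PSL27ToGL32.lean`, Bonnafé Prop 11.4.4) an explicit surjection `π : SL₂(𝔽₇) ↠ GL₃(𝔽₂)`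
   with kernel `{±I₂}` (`exists_surjective_sl27_ker_eq`), transported to any `Γ ≅ GL₃(𝔽₂)`;
2. for an injective `ρ : Γ → GL₃(ℂ)` the composite `σ = ρ ∘ π : SL₂(𝔽₇) → GL₃(ℂ)` has kernel
   exactly `{±I₂}`, and `det σ = 1` since `SL₂(𝔽₇)` is perfect (Bonnafé Thm 1.2.4 (a), §11.4.4:
   "`W⁺ ⊆ SL₃(ℂ)`"); `SL27TraceFacts.lean`;
3. (`PSL27.exists_P_charpoly_red`, the master computation) for `g ∈ SL₂(𝔽₇)` with `t = tr g`:
   * `t = ±2` (`g = ±u`, orders `1, 2, 7, 14`): `σ(g)⁷ = 1`, the eigenvalues are `7`-th roots of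
     unity, hence algebraic integers reducing to `1` in characteristic `7`
     (`x⁷ = 1 ⇒ (x-1)⁷ = 0`), and `χ ↦ (X-1)³ = (X-1)(X² - (t²-2)X + 1)`;
   * `t = 0` (order `4`, `g² = -I₂`): `σ(g)` is an involution `≠ 1` of determinant `1`, so
     `χ = (X-1)(X+1)² = (X-1)(X² + 2X + 1)`;
   * `t = ±1` (orders `3, 6`): `σ(g)³ = 1`; a scalar `σ(g)` would commute with `σ(T)`,
     `T = (1 1; 0 1)`, putting `g T g⁻¹ T⁻¹` in `ker σ = {±I₂}`, which forces `tr g = ±2`; with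
     `det = 1` this leaves `χ = X³ - 1 = (X-1)(X² + X + 1)`;
   * `t = ±3` (order `8`): `σ(g)⁴ = 1 ≠ σ(g)²`, `det = 1`, and `g ∼ g⁻¹` in `SL₂(𝔽₇)`
     (`sl27_exists_conj_eq_inv`) gives `χ_{σ(g)³} = χ_{σ(g)}`, excluding the spectra
     `{i, i, -1}`, `{-i, -i, -1}`; what is left is `χ = (X-1)(X²+1) ≡ (X-1)(X² - (t²-2)X + 1)`;
   (`FiniteOrderCharpolyGL3.lean` supplies the eigenvalue lemmas), matching Table 11.4:
   `R'_±(θ₀)` takes the values `3, 3, 0, 0, -1, 1, 1` on `I₂, -I₂, d(j), d(-j), d'(i), d'(ζ₈),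
   d'(ζ₈³)`.

## References

* [Bonnafe2011] C. Bonnafé, *Representations of `SL₂(𝔽_q)`*, Algebra and Applications 13,
  Springer (2011): Thm 1.2.4, Table 11.4, Prop 10.2.9 (f), §11.4.3, Prop 11.4.4, §11.4.4.
-/

noncomputable section

open Polynomial

open scoped MatrixGroups

namespace Literature.RepresentationTheory.FiniteGroups

namespace PSL27

/-! ### The master computation for a representation of `SL₂(𝔽₇)` with kernel `{±1}` -/

section Master

variable (σ : SL(2, ZMod 7) →* GL (Fin 3) ℂ)
  (hker : ∀ g : SL(2, ZMod 7), σ g = 1 ↔ g = 1 ∨ g = -1)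

include hker in
/-- `σ(g)ⁿ = 1` as a matrix when `gⁿ = ±1`. [folklore] -/
theorem val_pow_eq_one_of_pow_eq {g : SL(2, ZMod 7)} {n : ℕ} (h : g ^ n = 1 ∨ g ^ n = -1) :
    ((σ g : GL (Fin 3) ℂ) : Matrix (Fin 3) (Fin 3) ℂ) ^ n = 1 := by
  have h1 : σ (g ^ n) = 1 := (hker _).2 h
  rw [map_pow] at h1
  rw [← Units.val_pow_eq_pow_val, h1, Units.val_one]

include hker in
/-- `σ(g) ≠ 1` as a matrix when `g ≠ ±1`. [folklore] -/
theorem val_ne_one {g : SL(2, ZMod 7)} (hg : g ≠ 1 ∧ g ≠ -1) :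
    ((σ g : GL (Fin 3) ℂ) : Matrix (Fin 3) (Fin 3) ℂ) ≠ 1 := by
  intro h
  have h1 : σ g = 1 := Units.ext h
  rcases (hker g).1 h1 with h2 | h2
  · exact hg.1 h2
  · exact hg.2 h2

/-- **`det σ = 1`** (`SL₂(𝔽₇)` is perfect). [cite: Bonnafe2011, §11.4.4] -/
theorem det_val_eq_one (g : SL(2, ZMod 7)) :
    ((σ g : GL (Fin 3) ℂ) : Matrix (Fin 3) (Fin 3) ℂ).det = 1 := by
  have h := sl27_map_eq_one_of_comm (Matrix.GeneralLinearGroup.det.comp σ) g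
  rw [MonoidHom.comp_apply] at h
  have h2 := congrArg Units.val h
  rwa [Matrix.GeneralLinearGroup.val_det_apply, Units.val_one] at h2

/-- Conjugate elements have conjugate images: `h g h⁻¹ = g⁻¹ ⇒ χ_{σ(g)⁻¹} = χ_{σ(g)}`. [folklore] -/
theorem charpoly_inv_eq_of_conj {g h : SL(2, ZMod 7)} (hc : h * g * h⁻¹ = g⁻¹) :
    (((σ g)⁻¹ : GL (Fin 3) ℂ) : Matrix (Fin 3) (Fin 3) ℂ).charpoly =
      ((σ g : GL (Fin 3) ℂ) : Matrix (Fin 3) (Fin 3) ℂ).charpoly := by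
  have h1 : σ h * σ g * (σ h)⁻¹ = (σ g)⁻¹ := by rw [← map_mul, ← map_inv, ← map_mul, hc, map_inv]
  rw [← h1, Units.val_mul, Units.val_mul, Matrix.coe_units_inv, Matrix.charpoly_units_conj]

include hker in
/-- **`σ(g)` is not a scalar unless `tr g = ±2`**: a scalar `σ(g)` commutes with `σ(T)`, so
`g T g⁻¹ T⁻¹ ∈ ker σ = {±1}`, forcing `tr g = ±2` (`sl27_trace_of_commutator_T`). [folklore] -/
theorem val_ne_smul_one {g : SL(2, ZMod 7)} (h2 : (g : Matrix (Fin 2) (Fin 2) (ZMod 7)).trace ≠ 2)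
    (h5 : (g : Matrix (Fin 2) (Fin 2) (ZMod 7)).trace ≠ -2) (c : ℂ) :
    ((σ g : GL (Fin 3) ℂ) : Matrix (Fin 3) (Fin 3) ℂ) ≠ c • 1 := by
  intro hc
  let T : SL(2, ZMod 7) := ⟨!![1, 1; 0, 1], by rw [Matrix.det_fin_two_of]; ring⟩
  have hTc : (T : Matrix (Fin 2) (Fin 2) (ZMod 7)) = !![1, 1; 0, 1] := rfl
  have comm : σ g * σ T = σ T * σ g := by
    apply Units.ext
    rw [Units.val_mul, Units.val_mul, hc, smul_mul_assoc, one_mul, mul_smul_comm, mul_one]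
  have h1 : σ (g * T * g⁻¹ * T⁻¹) = 1 := by
    rw [map_mul, map_mul, map_mul, map_inv, map_inv, comm, mul_inv_cancel_right, mul_inv_cancel]
  rcases sl27_trace_of_commutator_T g T hTc ((hker _).1 h1) with h | h
  · exact h2 h
  · exact h5 h

/-- `7 = 0` in `k[X]` for `k` of characteristic `7`. [folklore] -/
theorem seven_eq_zero_poly (k : Type*) [CommRing k] [CharP k 7] : (7 : k[X]) = 0 := by
  simpa using CharP.cast_eq_zero k[X] 7

include hker in
/-- **The master computation.** For a homomorphism `σ : SL₂(𝔽₇) → GL₃(ℂ)` with kernel exactly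
`{±I₂}` and any `g`, `χ_{σ(g)}` has algebraic-integer coefficients and reduces modulo `7` to
`(X - 1)(X² - (tr(g)² - 2)X + 1)`. Cases on `t = tr g`: `t = ±2` — `σ(g)⁷ = 1`, all eigenvalues
reduce to `1`, and `(X-1)(X² - 2X + 1) = (X-1)³`; `t = 0` — `σ(g)` is a non-trivial involution
of determinant `1`, `χ = (X-1)(X+1)²`; `t = ±1` — `σ(g)³ = 1`, `σ(g)` non-scalar of determinant
`1`, `χ = X³ - 1`; `t = ±3` — `σ(g)⁴ = 1 ≠ σ(g)²`, determinant `1` and `σ(g) ∼ σ(g)⁻¹`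
(`g ∼ g⁻¹`), `χ = (X-1)(X²+1)`. [cite: Bonnafe2011, Table 11.4] -/
theorem exists_P_charpoly_red (k : Type*) [Field k] [CharP k 7] (red : integralClosure ℤ ℂ →+* k)
    (g : SL(2, ZMod 7)) :
    ∃ P : Polynomial (integralClosure ℤ ℂ),
      P.map (algebraMap (integralClosure ℤ ℂ) ℂ) =
        ((σ g : GL (Fin 3) ℂ) : Matrix (Fin 3) (Fin 3) ℂ).charpoly ∧
      P.map red = (X - 1) * (X ^ 2 - C ((ZMod.castHom (dvd_refl 7) k
        (g : Matrix (Fin 2) (Fin 2) (ZMod 7)).trace) ^ 2 - 2) * X + 1) := by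
  set M : Matrix (Fin 3) (Fin 3) ℂ := ((σ g : GL (Fin 3) ℂ) : Matrix (Fin 3) (Fin 3) ℂ) with hM
  have hdet : M.det = 1 := det_val_eq_one σ g
  have h7k : (7 : k[X]) = 0 := seven_eq_zero_poly k
  have htr : ∀ t : ZMod 7, t = 0 ∨ t = 1 ∨ t = 2 ∨ t = 3 ∨ t = 4 ∨ t = 5 ∨ t = 6 := by decide
  rcases htr (g : Matrix (Fin 2) (Fin 2) (ZMod 7)).trace with ht | ht | ht | ht | ht | ht | ht
  · -- `t = 0`: involution
    have hM2 : M ^ 2 = 1 := val_pow_eq_one_of_pow_eq σ hker (Or.inr (sl27_sq_of_trace_zero g ht))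
    have hne : M ≠ 1 :=
      val_ne_one σ hker (sl27_ne_one_and_ne_neg_one g ht (by decide) (by decide))
    have hchar : M.charpoly = (X - 1) * (X + 1) ^ 2 := by
      rcases charpoly_of_sq_eq_one M hM2 hdet with h | h
      · exfalso
        refine hne (eq_one_of_unipotent M (n := 2) (Or.inl rfl) ?_ hM2)
        have := Matrix.aeval_self_charpoly M
        rw [h] at this
        simpa using this
      · exact h
    obtain ⟨P, hP1, hP2⟩ := exists_P_of_charpoly_eq_map M ((X - 1) * (X + 1) ^ 2)
      (by rw [hchar]; simp [Polynomial.map_mul, Polynomial.map_pow, Polynomial.map_sub]) k red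
    refine ⟨P, hP1, ?_⟩
    rw [hP2, ht, map_zero]
    simp only [Polynomial.map_mul, Polynomial.map_pow, Polynomial.map_sub, Polynomial.map_add,
      Polynomial.map_X, Polynomial.map_one, ne_eq, OfNat.ofNat_ne_zero, not_false_eq_true,
      zero_pow, zero_sub, map_neg, map_ofNat]
    ring1
  · -- `t = 1`: order `6`, `σ(g)³ = 1`
    have hM3 : M ^ 3 = 1 :=
      val_pow_eq_one_of_pow_eq σ hker (Or.inr (sl27_pow_three_of_trace_one g ht))
    have hne : M ≠ 1 :=
      val_ne_one σ hker (sl27_ne_one_and_ne_neg_one g ht (by decide) (by decide))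
    have hchar : M.charpoly = X ^ 3 - 1 := by
      rcases charpoly_of_pow_three_eq_one M hM3 hdet with ⟨c, hc3, h⟩ | h
      · exfalso
        have hc0 : c ≠ 0 := by rintro rfl; norm_num at hc3
        -- `M = c • 1`: apply the unipotent lemma to `c⁻¹ • M`
        have hCH : (M - c • 1) ^ 3 = 0 := by
          have := Matrix.aeval_self_charpoly M
          rw [h] at this
          simpa [Algebra.algebraMap_eq_smul_one] using this
        have hM' : c⁻¹ • M = 1 := by
          refine eq_one_of_unipotent (c⁻¹ • M) (n := 3) (Or.inr (Or.inl rfl)) ?_ ?_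
          · have e : c⁻¹ • M - 1 = c⁻¹ • (M - c • 1) := by
              rw [smul_sub, smul_smul, inv_mul_cancel₀ hc0, one_smul]
            rw [e, smul_pow, hCH, smul_zero]
          · rw [smul_pow, hM3, inv_pow, hc3, inv_one, one_smul]
        refine val_ne_smul_one σ hker (by rw [ht]; decide) (by rw [ht]; decide) c ?_
        rw [← hM, ← hM', smul_smul, mul_inv_cancel₀ hc0, one_smul]
      · exact h
    obtain ⟨P, hP1, hP2⟩ := exists_P_of_charpoly_eq_map M (X ^ 3 - 1)
      (by rw [hchar]; simp [Polynomial.map_pow, Polynomial.map_sub]) k red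
    refine ⟨P, hP1, ?_⟩
    rw [hP2, ht, map_one]
    simp only [Polynomial.map_pow, Polynomial.map_sub, Polynomial.map_X, Polynomial.map_one,
      one_pow, map_sub, map_one, map_ofNat]
    ring1
  · -- `t = 2`: order `1` or `7`
    have hM7 : M ^ 7 = 1 :=
      val_pow_eq_one_of_pow_eq σ hker (Or.inl (sl27_pow_seven_of_trace_two g ht))
    obtain ⟨P, hP1, hP2⟩ := exists_P_of_pow_seven M hM7 k red
    refine ⟨P, hP1, ?_⟩
    rw [hP2, ht, map_ofNat]
    simp only [map_sub, map_pow, map_ofNat]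
    ring1
  · -- `t = 3`: order `8`
    have hM4 : M ^ 4 = 1 :=
      val_pow_eq_one_of_pow_eq σ hker (Or.inr (sl27_pow_four_of_trace_three g ht))
    have hsq : g ^ 2 ≠ 1 ∧ g ^ 2 ≠ -1 := by
      refine sl27_ne_one_and_ne_neg_one (g ^ 2) (t := 0) ?_ (by decide) (by decide)
      rw [pow_two, sl2_trace_mul_self, ht]; decide
    have hM2 : M ^ 2 ≠ 1 := by
      have := val_ne_one σ hker hsq
      rwa [map_pow, Units.val_pow_eq_pow_val] at this
    obtain ⟨h, hconj⟩ := sl27_exists_conj_eq_inv g (by rw [ht]; decide)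
    have hinv : (((σ g)⁻¹ : GL (Fin 3) ℂ) : Matrix (Fin 3) (Fin 3) ℂ) = M ^ 3 := by
      rw [inv_eq_of_mul_eq_one_right (a := σ g) (b := σ g ^ 3)
        (by rw [← pow_succ', ← Units.val_eq_one, Units.val_pow_eq_pow_val]; exact hM4),
        Units.val_pow_eq_pow_val]
    have hcc : (M ^ 3).charpoly = M.charpoly := by
      rw [← hinv]; exact charpoly_inv_eq_of_conj σ hconj
    have hchar : M.charpoly = (X - 1) * (X ^ 2 + 1) := by
      rcases charpoly_of_pow_four_eq_one M hM4 hdet with h | h | h | ⟨s, hs2, h⟩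
      · exfalso
        refine hM2 ?_
        have h1 : M = 1 := by
          refine eq_one_of_unipotent M (n := 4) (Or.inr (Or.inr rfl)) ?_ hM4
          have := Matrix.aeval_self_charpoly M
          rw [h] at this
          simpa using this
        rw [h1, one_pow]
      · exfalso
        refine hM2 (sq_eq_one_of_charpoly M ?_ hM4)
        have := Matrix.aeval_self_charpoly M
        rw [h] at this
        simpa using this
      · exact h
      · exfalso
        -- `s` is an eigenvalue of `M`, hence `s³` one of `M³ ∼ M`; but `s³ = -s ∉ {s, -1}`
        have hs0 : s ≠ 0 := by rintro rfl; norm_num at hs2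
        have hr : M.charpoly.IsRoot s := by rw [h]; simp
        have hr3 := isRoot_charpoly_pow M hr 3
        rw [hcc, h] at hr3
        simp only [IsRoot.def, eval_mul, eval_pow, eval_sub, eval_add, eval_X, eval_C, eval_one,
          mul_eq_zero, pow_eq_zero_iff, ne_eq, OfNat.ofNat_ne_zero, not_false_eq_true] at hr3
        have hs3 : s ^ 3 = -s := by rw [pow_succ, hs2]; ring
        rw [hs3] at hr3
        rcases hr3 with h3 | h3
        · apply hs0; linear_combination h3 / (-2)
        · have hs1 : s = 1 := by linear_combination -h3
          rw [hs1] at hs2; norm_num at hs2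
    obtain ⟨P, hP1, hP2⟩ := exists_P_of_charpoly_eq_map M ((X - 1) * (X ^ 2 + 1))
      (by rw [hchar]; simp [Polynomial.map_mul, Polynomial.map_pow, Polynomial.map_sub]) k red
    refine ⟨P, hP1, ?_⟩
    rw [hP2, ht, map_ofNat]
    simp only [Polynomial.map_mul, Polynomial.map_pow, Polynomial.map_sub, Polynomial.map_add,
      Polynomial.map_X, Polynomial.map_one, map_sub, map_pow, map_ofNat]
    linear_combination (X * (X - 1)) * h7k
  · -- `t = 4 = -3`: order `8`
    have hM4 : M ^ 4 = 1 :=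
      val_pow_eq_one_of_pow_eq σ hker (Or.inr (sl27_pow_four_of_trace_four g ht))
    have hsq : g ^ 2 ≠ 1 ∧ g ^ 2 ≠ -1 := by
      refine sl27_ne_one_and_ne_neg_one (g ^ 2) (t := 0) ?_ (by decide) (by decide)
      rw [pow_two, sl2_trace_mul_self, ht]; decide
    have hM2 : M ^ 2 ≠ 1 := by
      have := val_ne_one σ hker hsq
      rwa [map_pow, Units.val_pow_eq_pow_val] at this
    obtain ⟨h, hconj⟩ := sl27_exists_conj_eq_inv g (by rw [ht]; decide)
    have hinv : (((σ g)⁻¹ : GL (Fin 3) ℂ) : Matrix (Fin 3) (Fin 3) ℂ) = M ^ 3 := by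
      rw [inv_eq_of_mul_eq_one_right (a := σ g) (b := σ g ^ 3)
        (by rw [← pow_succ', ← Units.val_eq_one, Units.val_pow_eq_pow_val]; exact hM4),
        Units.val_pow_eq_pow_val]
    have hcc : (M ^ 3).charpoly = M.charpoly := by
      rw [← hinv]; exact charpoly_inv_eq_of_conj σ hconj
    have hchar : M.charpoly = (X - 1) * (X ^ 2 + 1) := by
      rcases charpoly_of_pow_four_eq_one M hM4 hdet with h | h | h | ⟨s, hs2, h⟩
      · exfalso
        refine hM2 ?_
        have h1 : M = 1 := by
          refine eq_one_of_unipotent M (n := 4) (Or.inr (Or.inr rfl)) ?_ hM4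
          have := Matrix.aeval_self_charpoly M
          rw [h] at this
          simpa using this
        rw [h1, one_pow]
      · exfalso
        refine hM2 (sq_eq_one_of_charpoly M ?_ hM4)
        have := Matrix.aeval_self_charpoly M
        rw [h] at this
        simpa using this
      · exact h
      · exfalso
        have hs0 : s ≠ 0 := by rintro rfl; norm_num at hs2
        have hr : M.charpoly.IsRoot s := by rw [h]; simp
        have hr3 := isRoot_charpoly_pow M hr 3
        rw [hcc, h] at hr3
        simp only [IsRoot.def, eval_mul, eval_pow, eval_sub, eval_add, eval_X, eval_C, eval_one,
          mul_eq_zero, pow_eq_zero_iff, ne_eq, OfNat.ofNat_ne_zero, not_false_eq_true] at hr3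
        have hs3 : s ^ 3 = -s := by rw [pow_succ, hs2]; ring
        rw [hs3] at hr3
        rcases hr3 with h3 | h3
        · apply hs0; linear_combination h3 / (-2)
        · have hs1 : s = 1 := by linear_combination -h3
          rw [hs1] at hs2; norm_num at hs2
    obtain ⟨P, hP1, hP2⟩ := exists_P_of_charpoly_eq_map M ((X - 1) * (X ^ 2 + 1))
      (by rw [hchar]; simp [Polynomial.map_mul, Polynomial.map_pow, Polynomial.map_sub]) k red
    refine ⟨P, hP1, ?_⟩
    rw [hP2, ht, map_ofNat]
    simp only [Polynomial.map_mul, Polynomial.map_pow, Polynomial.map_sub, Polynomial.map_add,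
      Polynomial.map_X, Polynomial.map_one, map_sub, map_pow, map_ofNat]
    linear_combination (2 * X * (X - 1)) * h7k
  · -- `t = 5 = -2`: order `2` or `14`
    have hM7 : M ^ 7 = 1 :=
      val_pow_eq_one_of_pow_eq σ hker (Or.inr (sl27_pow_seven_of_trace_five g ht))
    obtain ⟨P, hP1, hP2⟩ := exists_P_of_pow_seven M hM7 k red
    refine ⟨P, hP1, ?_⟩
    rw [hP2, ht, map_ofNat]
    simp only [map_sub, map_pow, map_ofNat]
    linear_combination (3 * X * (X - 1)) * h7k
  · -- `t = 6 = -1`: order `3`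
    have hM3 : M ^ 3 = 1 :=
      val_pow_eq_one_of_pow_eq σ hker (Or.inl (sl27_pow_three_of_trace_six g ht))
    have hchar : M.charpoly = X ^ 3 - 1 := by
      rcases charpoly_of_pow_three_eq_one M hM3 hdet with ⟨c, hc3, h⟩ | h
      · exfalso
        have hc0 : c ≠ 0 := by rintro rfl; norm_num at hc3
        have hCH : (M - c • 1) ^ 3 = 0 := by
          have := Matrix.aeval_self_charpoly M
          rw [h] at this
          simpa [Algebra.algebraMap_eq_smul_one] using this
        have hM' : c⁻¹ • M = 1 := by
          refine eq_one_of_unipotent (c⁻¹ • M) (n := 3) (Or.inr (Or.inl rfl)) ?_ ?_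
          · have e : c⁻¹ • M - 1 = c⁻¹ • (M - c • 1) := by
              rw [smul_sub, smul_smul, inv_mul_cancel₀ hc0, one_smul]
            rw [e, smul_pow, hCH, smul_zero]
          · rw [smul_pow, hM3, inv_pow, hc3, inv_one, one_smul]
        refine val_ne_smul_one σ hker (by rw [ht]; decide) (by rw [ht]; decide) c ?_
        rw [← hM, ← hM', smul_smul, mul_inv_cancel₀ hc0, one_smul]
      · exact h
    obtain ⟨P, hP1, hP2⟩ := exists_P_of_charpoly_eq_map M (X ^ 3 - 1)
      (by rw [hchar]; simp [Polynomial.map_pow, Polynomial.map_sub]) k red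
    refine ⟨P, hP1, ?_⟩
    rw [hP2, ht, map_ofNat]
    simp only [Polynomial.map_pow, Polynomial.map_sub, Polynomial.map_X, Polynomial.map_one,
      map_sub, map_pow, map_ofNat]
    linear_combination (5 * X * (X - 1)) * h7k

end Master

end PSL27

/-- **Discharge of `psl27_degreeThree_charpoly_mod_seven`.** The surjection
`π : SL₂(𝔽₇) ↠ Γ ≅ GL₃(𝔽₂)` with kernel `{±I₂}` is `exists_surjective_sl27_ker_eq`
(Bonnafé Prop 11.4.4, made explicit in `PSL27ToGL32.lean`); for an injective `ρ : Γ → GL₃(ℂ)`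
the composite `σ = ρ ∘ π` has kernel exactly `{±I₂}`, and `PSL27.exists_P_charpoly_red`
computes the reduction of `χ_{σ(g)}` modulo `7` class by class (Bonnafé Table 11.4: orders
`1, 2, 3, 4, 6, 7, 8, 14` ↔ traces `2, -2, -1, 0, 1, 2, ±3, -2`).
[cite: Bonnafe2011, Table 11.4, Prop 10.2.9 (f), Prop 11.4.4] -/
theorem psl27_degreeThree_charpoly_mod_seven_holds : psl27_degreeThree_charpoly_mod_seven := by
  intro Γ _ hΓ
  obtain ⟨e⟩ := hΓ
  obtain ⟨π, hπs, hπk⟩ := exists_surjective_sl27_ker_eq Γ e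
  refine ⟨π, hπs, fun g => ?_, fun ρ hρ k _ _ red g => ?_⟩
  · rw [hπk g]
    constructor
    · rintro (rfl | rfl)
      · exact Or.inl rfl
      · exact Or.inr rfl
    · rintro (h | h)
      · exact Or.inl (Subtype.ext h)
      · exact Or.inr (Subtype.ext h)
  · have hker : ∀ g : SL(2, ZMod 7), ρ.comp π g = 1 ↔ g = 1 ∨ g = -1 := fun g => by
      rw [MonoidHom.comp_apply, map_eq_one_iff ρ hρ, hπk g]
    exact PSL27.exists_P_charpoly_red (ρ.comp π) hker k red g

end Literature.RepresentationTheory.FiniteGroups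

end
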